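import Mathlib
import HarnessLib
import Summits.Ventures.LatticeQCDFlow.Exactness.NCMCGeneralSpaceSteps

/-!
# Tempered transitions on a general state space: the round trip of a Crooks pair is reversible

HONEST FRAMING: exact (Metropolis-corrected) sampling algorithms for lattice gauge theory;
figures of merit are autocorrelation/cost numbers at stated couplings and volumes; no
continuum-physics claim.

Venture `LatticeQCDFlow` (cell pub-lqcd), topic `Exactness`; FANOUT row 13 (`eng-snf`, GEN-9).
NEW WORK of the cell (general measure theory, elementary), not a published result; nothing is
cited as a fact (R. M. Neal, Statistics and Computing 6 (1996) 353 "tempered transitions" and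
Crooks 1998/2000 named only).  General-state-space counterpart of the finite
`Exactness/TemperedTransitions.lean` (`temperedKernel_detailedBalance`), which types the
`snf.tempered` mode of `latflow-snf` on a finite configuration space; built on
`NCMCGeneralSpace.lean` (Crooks pairs, accepted flows, `levelBalance`) and
`NCMCGeneralSpaceSteps.lean` (`compFwd` / `compRev`, `CrooksPair.comp`).

## Content (general measurable `Ω` with measurable singletons; records `E`; Markov record kernels)

* `CrooksPair.symm` — a Crooks pair from `ν₀` to `ν₁` read backwards (levels, kernels and
  start / end maps exchanged, work `−W`) is a Crooks pair from `ν₁` to `ν₀`;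
* `CrooksPair.roundTrip` — hence UP with the forward protocol, then DOWN with the reverse protocol
  from the point reached (records `E × E`, work `W(up) − W(down record)`) is a Crooks pair from `ν₀`
  to ITSELF (`= h.comp h.symm`); `compRev_eq_map_compFwd` — its reverse record kernel is the
  forward one with the legs swapped;
* `ttKernel κ W e : Kernel Ω Ω` — propose the end point of a record drawn from `κ`, accept with
  `min 1 e^{-W}`, else stay (`ttKernel_apply`, `isMarkovKernel_ttKernel`);
* `ttKernel_isReversible_of_flow_eq` — a Crooks pair from `ν` to `ν` whose accepted reverse flow
  equals its accepted forward flow makes `ttKernel` `ν`-reversible (`levelBalance` at `c = 0`);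
* **`temperedTransition_isReversible`**, `temperedTransition_invariant` — for EVERY Crooks pair,
  the tempered-transition kernel of its round trip is `ν₀`-reversible (Mathlib
  `Kernel.IsReversible`) and leaves `ν₀` invariant: Neal's tempered transitions through any
  protocol of adjoint stochastic steps and Jacobian-charged layers are exact on the engine's state
  space.
-/

namespace Summit.Ventures.LatticeQCDFlow.Exactness.GeneralNCMC

open MeasureTheory ProbabilityTheory Set
open scoped ENNReal

variable {Ω : Type*} [MeasurableSpace Ω]

/-! ## Reversed pairs, round trips, tempered transitions -/

section Tempered

variable {E : Type*} [MeasurableSpace E]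

/-- **A Crooks pair read backwards is a Crooks pair**: exchanging the roles of the levels, of the
forward / reverse record kernels and of the start / end maps, and charging the work `−W`, turns a
Crooks pair from `ν₀` to `ν₁` into one from `ν₁` to `ν₀` (`e^{W} · (ν₁ ∘ κR) = ν₀ ∘ κF`). -/
theorem CrooksPair.symm {ν₀ ν₁ : Measure Ω} {κF κR : Kernel Ω E} {s e : E → Ω} {W : E → ℝ}
    (h : CrooksPair ν₀ ν₁ κF κR s e W) : CrooksPair ν₁ ν₀ κR κF e s (fun ε => -W ε) where
  measurable_s := h.measurable_e
  measurable_e := h.measurable_s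
  measurable_W := h.measurable_W.neg
  start_ae := h.end_ae
  end_ae := h.start_ae
  crooks := by
    have hm : Measurable fun ε => ENNReal.ofReal (Real.exp (-W ε)) :=
      (Real.measurable_exp.comp h.measurable_W.neg).ennreal_ofReal
    have hp : Measurable fun ε => ENNReal.ofReal (Real.exp (-(-W ε))) :=
      (Real.measurable_exp.comp h.measurable_W.neg.neg).ennreal_ofReal
    rw [← h.crooks, ← withDensity_mul _ hm hp]
    have h1 : ((fun ε => ENNReal.ofReal (Real.exp (-W ε))) * fun ε => ENNReal.ofReal (Real.exp (-(-W ε)))) =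
        1 := by
      funext ε
      simp only [Pi.mul_apply, Pi.one_apply]
      rw [← ENNReal.ofReal_mul (Real.exp_pos _).le, ← Real.exp_add, show -W ε + -(-W ε) = 0 by ring,
        Real.exp_zero, ENNReal.ofReal_one]
    rw [h1, withDensity_one]

variable [MeasurableSingletonClass Ω]

/-- **The round trip of a Crooks pair** (up with the forward protocol, then down with the reverse
protocol from the point reached; works added, the down work being `−W` of its record) is a Crooks
pair from `ν₀` to ITSELF — the proposal of Neal's tempered transitions / of a two-sided
non-equilibrium candidate move. -/
theorem CrooksPair.roundTrip {ν₀ ν₁ : Measure Ω} [SFinite ν₀] [SFinite ν₁] {κF κR : Kernel Ω E}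
    [IsMarkovKernel κF] [IsMarkovKernel κR] {s e : E → Ω} {W : E → ℝ}
    (h : CrooksPair ν₀ ν₁ κF κR s e W) :
    CrooksPair ν₀ ν₀ (compFwd κF κR e h.measurable_e) (compRev κR κF e h.measurable_e)
      (fun ε => s ε.1) (fun ε => s ε.2) (fun ε => W ε.1 + -W ε.2) :=
  h.comp h.symm

omit [MeasurableSingletonClass Ω] in
/-- For the round trip the reverse record kernel is the forward one with the two legs swapped
(definitionally). -/
theorem compRev_eq_map_compFwd (κF κR : Kernel Ω E) (e : E → Ω) (he : Measurable e) :
    compRev κR κF e he = Kernel.map (compFwd κF κR e he) Prod.swap := rfl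

/-- **Tempered-transition kernel on a general state space**: propose the end point of a round
trip, accept with `min 1 e^{-W_rt}`, else stay.  Written for any record kernel `κ`, work `W` and
end map `e` (for tempered transitions: `κ = compFwd κF κR e _`, `W` the round-trip work,
`e = s ∘ snd`). -/
noncomputable def ttKernel (κ : Kernel Ω E) [IsMarkovKernel κ] (W : E → ℝ) (e : E → Ω) :
    Kernel Ω Ω :=
  Kernel.map (Kernel.withDensity κ fun _ => accF 0 W) e +
    Kernel.withDensity Kernel.id fun x _ => 1 - fwdFlow κ 0 W e x univ

omit [MeasurableSingletonClass Ω] in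
/-- Set-wise formula: `K(x, B) = F_0(x, B) + (1 − F_0(x, Ω)) 1_B(x)`. -/
theorem ttKernel_apply {κ : Kernel Ω E} [IsMarkovKernel κ] {W : E → ℝ} {e : E → Ω}
    (hW : Measurable W) (he : Measurable e) (x : Ω) {B : Set Ω} (hB : MeasurableSet B) :
    ttKernel κ W e x B = fwdFlow κ 0 W e x B + (1 - fwdFlow κ 0 W e x univ) * B.indicator 1 x := by
  have hacc : Measurable (Function.uncurry fun (_ : Ω) (ε : E) => accF 0 W ε) :=
    (measurable_accF 0 hW).comp measurable_snd
  have hstay : Measurable (Function.uncurry fun (x : Ω) (_ : Ω) => 1 - fwdFlow κ 0 W e x univ) :=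
    measurable_const.sub ((measurable_fwdFlow κ 0 hW he MeasurableSet.univ).comp measurable_fst)
  rw [ttKernel, Kernel.add_apply, Measure.add_apply, Kernel.map_apply' _ he _ hB,
    Kernel.withDensity_apply' _ hacc, Kernel.withDensity_apply' _ hstay, Kernel.id_apply,
    setLIntegral_const, Measure.dirac_apply' _ hB]
  congr 1
  rw [fwdFlow, CrooksPair.setLIntegral_eq_indicator_mul _ (he hB)]
  refine lintegral_congr fun ε => ?_
  rw [mul_comm]
  rfl

omit [MeasurableSingletonClass Ω] in
/-- The tempered-transition kernel is Markov. -/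
theorem isMarkovKernel_ttKernel {κ : Kernel Ω E} [IsMarkovKernel κ] {W : E → ℝ} {e : E → Ω}
    (hW : Measurable W) (he : Measurable e) : IsMarkovKernel (ttKernel κ W e) := by
  refine ⟨fun x => ⟨?_⟩⟩
  rw [ttKernel_apply hW he x MeasurableSet.univ, indicator_univ, Pi.one_apply, mul_one]
  exact add_tsub_cancel_of_le (fwdFlow_le_one κ 0 W e x univ)

omit [MeasurableSingletonClass Ω] in
/-- **A self-pair with symmetric flows gives a reversible one-level kernel.**  If `(κF, κR, s, e, W)`
is a Crooks pair from `ν` to ITSELF whose accepted reverse flow coincides with its accepted forward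
flow, then `ttKernel κF W e` is `ν`-reversible (`CrooksPair.levelBalance` at `c = 0`; the rejected
mass sits on the diagonal). -/
theorem ttKernel_isReversible_of_flow_eq {ν : Measure Ω} {κF κR : Kernel Ω E} [IsMarkovKernel κF]
    {s e : E → Ω} {W : E → ℝ} (h : CrooksPair ν ν κF κR s e W)
    (hflow : ∀ y, ∀ A, MeasurableSet A → revFlow κR 0 W s y A = fwdFlow κF 0 W e y A) :
    Kernel.IsReversible (ttKernel κF W e) ν := by
  have hW := h.measurable_W
  have he := h.measurable_e
  have hFu : Measurable fun x => 1 - fwdFlow κF 0 W e x univ :=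
    measurable_const.sub (measurable_fwdFlow κF 0 hW he MeasurableSet.univ)
  -- the mass flow `∫_A K(x, B) dν` as accepted flow + rejected diagonal mass
  have hsplit : ∀ {A B : Set Ω}, MeasurableSet A → MeasurableSet B →
      ∫⁻ x in A, ttKernel κF W e x B ∂ν =
        ∫⁻ x in A, fwdFlow κF 0 W e x B ∂ν + ∫⁻ x in B ∩ A, (1 - fwdFlow κF 0 W e x univ) ∂ν := by
    intro A B hA hB
    simp_rw [ttKernel_apply hW he _ hB]
    rw [lintegral_add_left (measurable_fwdFlow κF 0 hW he hB)]
    congr 1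
    have hind : ∀ x, (1 - fwdFlow κF 0 W e x univ) * B.indicator 1 x =
        B.indicator (fun x => 1 - fwdFlow κF 0 W e x univ) x := fun x => by
      by_cases hx : x ∈ B
      · rw [indicator_of_mem hx, indicator_of_mem hx, Pi.one_apply, mul_one]
      · rw [indicator_of_notMem hx, indicator_of_notMem hx, mul_zero]
    simp_rw [hind]
    rw [lintegral_indicator hB, Measure.restrict_restrict hB]
  intro A B hA hB
  rw [hsplit hA hB, hsplit hB hA, Set.inter_comm, h.levelBalance 0 hA hB, Real.exp_zero,
    ENNReal.ofReal_one, one_mul]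
  congr 1
  exact lintegral_congr fun y => hflow y A hA

/-- **Tempered transitions are exact on a general state space.**  For every Crooks pair from `ν₀`
to `ν₁` (forward / reverse protocols `κF`, `κR`), the round-trip move — up with `κF`, down with
`κR` from the point reached, accept the final point with `min 1 e^{-(W_up − W(down record))}` —
is `ν₀`-REVERSIBLE (Mathlib `Kernel.IsReversible`); finite version:
`TemperedTransitions.temperedKernel_detailedBalance`. -/
theorem temperedTransition_isReversible {ν₀ ν₁ : Measure Ω} [SFinite ν₀] [SFinite ν₁]
    {κF κR : Kernel Ω E} [IsMarkovKernel κF] [IsMarkovKernel κR] {s e : E → Ω} {W : E → ℝ}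
    (h : CrooksPair ν₀ ν₁ κF κR s e W) :
    Kernel.IsReversible
      (ttKernel (compFwd κF κR e h.measurable_e) (fun ε => W ε.1 + -W ε.2) fun ε => s ε.2) ν₀ := by
  refine ttKernel_isReversible_of_flow_eq h.roundTrip fun y A hA => ?_
  -- the reverse flow of the round trip is its forward flow with the legs swapped
  have hacc : Measurable (accR 0 fun ε : E × E => W ε.1 + -W ε.2) :=
    measurable_accR 0 ((h.measurable_W.comp measurable_fst).add (h.measurable_W.comp measurable_snd).neg)
  have hind : Measurable fun ε : E × E => A.indicator (1 : Ω → ℝ≥0∞) (s ε.1) :=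
    (measurable_one.indicator hA).comp (h.measurable_s.comp measurable_fst)
  have hm : Measurable fun ε : E × E =>
      accR 0 (fun ε : E × E => W ε.1 + -W ε.2) ε * A.indicator 1 (s ε.1) := hacc.mul hind
  rw [revFlow, fwdFlow, compRev_eq_map_compFwd, Kernel.map_apply _ measurable_swap,
    lintegral_map hm measurable_swap]
  refine lintegral_congr fun ε => ?_
  simp only [accR, accF, Prod.fst_swap, Prod.snd_swap]
  congr 3
  ring

/-- … hence they leave `ν₀` invariant. -/
theorem temperedTransition_invariant {ν₀ ν₁ : Measure Ω} [SFinite ν₀] [SFinite ν₁]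
    {κF κR : Kernel Ω E} [IsMarkovKernel κF] [IsMarkovKernel κR] {s e : E → Ω} {W : E → ℝ}
    (h : CrooksPair ν₀ ν₁ κF κR s e W) :
    Kernel.Invariant
      (ttKernel (compFwd κF κR e h.measurable_e) (fun ε => W ε.1 + -W ε.2) fun ε => s ε.2) ν₀ := by
  have hW' : Measurable fun ε : E × E => W ε.1 + -W ε.2 :=
    (h.measurable_W.comp measurable_fst).add (h.measurable_W.comp measurable_snd).neg
  have hs' : Measurable fun ε : E × E => s ε.2 := h.measurable_s.comp measurable_snd
  haveI := isMarkovKernel_ttKernel (κ := compFwd κF κR e h.measurable_e) hW' hs'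
  exact (temperedTransition_isReversible h).invariant

end Tempered

end Summit.Ventures.LatticeQCDFlow.Exactness.GeneralNCMC
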